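/-
Copyright (c) 2026 the pub-hodgecm-mathlib formalisation cell (harness21).  Prover seat hodgecm-mathlib-F0P3a-p05 (g18): road «S3-ram» (LEAD F0P3a-plan (g13); owner
F0P3a-p06 (g15); (Cnt2′) chair F0P3a-p07 (g14)), organ (z1-f) «W-SIDE CURRENCY BRIDGE, RANK 2», part V: the PLAIN balls at general depth at the CM place; 2026-09-02.
-/
import Literature.NumberTheory.Rogawski1990.DepthZeroKappaTransferTypeTwoRamifiedWSideLatticeCurrencyTotal   -- ★ p848596 (this seat) part IV; brings parts I–III ((B-i) both parities in lattice currency, `v_half_trace_*`, ★ p848132 dictionary)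
import Literature.NumberTheory.Automorphic.UnitaryLatticeTreeTypeTwoCentredParity                       -- ★ p848431 (F0P3a-p08 (g20)) «PARITY REMARKS»: (W1) `map_sub_one_le_scaleLattice_of_fixed_selfDual_two`, (W3) `map_sub_smul_one_le_scaleLattice_succ_of_even_two`
import HarnessLib

/-!
# The W-side lattice currency of the (T2) rows at a tame-ramified place, V — the PLAIN balls `#{B ∣ SD, ΓB = B, (Γ − 1)B ⊆ ϖ^D B}` at every depth `D ≥ 1`
# (Labesse–Langlands 1979 §2; Kottwitz 1986 §3; Rogawski 1990 §4.9)

Topic `NumberTheory/Rogawski1990`; namespace `Literature.NumberTheory.Automorphic.UnitaryGroup`.  THEOREMS ONLY (no definition, no instance, no notation, no named fact,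
no `sorry`); kernel lane `--supports stmt-HodgeConjecture-24833`.  Cell `pub/hodgecm-mathlib` (D-0151), crux H413; road «S3-ram» (Literature seeding, count-neutral), (T2) G-side
organ (Cnt2′) of F0P3a-p07 (g14)'s skeleton, sub-organ **(z1-f)** «W-SIDE CURRENCY BRIDGE, RANK 2», part V of ★ p848258 ∕ p848350 ∕ p848544 ∕ p848596, cut for ROUTE B (chair
RULINGS (8)–(10): F0P2-p02 (g14)'s ★ `strataCount_J₀_block` runs the engine from the ROOT REGION `R = {fixed ∧ SD ∧ LEV(ϖ^D)}`; on the axis of the hyperbolic literal `R` is, through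
the ★ (z1-e) transport `ncard_selfDual_fixed_axis_lev_eq` (`c := ϖ^D`), the W-side PLAIN ball counted here — the `sR.card` of the block run).

* §0 (generic, datum-free, namespace `UnitaryLatticeTree`): **`v_half_trace_sub_one_le_of_map_sub_one_le_scaleLattice`** — if `(Γ − 1)·(g·𝒪²) ⊆ r·(g·𝒪²)` for SOME `g ∈ GL₂(K)` then
  `|½trΓ − 1| ≤ |r|` (`|2| = 1`; the trace of the integral matrix `r⁻¹·g⁻¹(Γ−1)g`) — so the PLAIN radius-`r` ball is EMPTY unless `|½trΓ − 1| ≤ |r|`, and the block run's root token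
  `hroot` supplies the hypothesis `hcD` of §1; **`scaleLattice_pow_succ_le`** — `ϖ^(k+1)·M ≤ ϖ^k·M`.
* §1 (CM place) **`ncard_selfDual_fixed_lev_pow_eq_of_even_depth_ramified`** ∕ **`…_of_odd_depth_ramified`**: for a type-(2) `γ₂ ∈ U₂` of discriminant depth `exp(−2·2n)` ∕
  `exp(−2(2n+1))` at a tame-ramified place, `Γ := e₂γ₂`, `D ≥ 1` with `D∕2 < n` ∕ `D∕2 ≤ n` and `|½trΓ − 1| ≤ |ϖ^D|`:
  `#{B ∣ SD, ΓB = B, (Γ−1)B ⊆ ϖ^D B} = (q+1)·Σ_(k<n−D∕2) q^k` ∕ `… + 1 = 2·Σ_(k<n−D∕2+1) q^k`.  Mechanism: PLAIN `LEV_{Γ−1}(ϖ^D)` ⟺ CENTRED `LEV_{Γ−c·1}(ϖ^D)` under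
  `|c − 1| ≤ |ϖ^D|` (★ p848132 `map_sub_smul_one_le_scaleLattice_iff_map_sub_one_le`); `D = 2j`: ★ (B-i) in lattice currency; `D = 2j+1`: «ODD SCALES ARE FREE» — the centred ball
  of radius `ϖ^(2j+1)` IS the centred ball of radius `ϖ^(2j)` (★ p848431 (W3) `map_sub_smul_one_le_scaleLattice_succ_of_even_two` for `j ≥ 1` since `|c² − det Γ| = |ϖ|^(2N) <
  |ϖ|^(4j)`; (W1) `map_sub_one_le_scaleLattice_of_fixed_selfDual_two` for `j = 0`), then ★ (B-i) at `j`.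

HONEST LABEL: HC_CM is proved only modulo the 2 remaining named inputs (hLiu418 24832, h413 24833) until rung 0 closes; nothing printed is asserted here (currency bookkeeping over ★
results); «S3-ram» has no books consequence.

## References
* [LabesseLanglands1979] J.-P. Labesse, R. P. Langlands, *L-indistinguishability for SL(2)*, Canad. J. Math. 31 (1979): §2 Lemma 2.1 pp. 7–8.
* [Kottwitz1986] R. E. Kottwitz, *Base change for unit elements of Hecke algebras*, Compositio Math. 60 (1986): §3.
* [Rogawski1990] J. D. Rogawski, *Automorphic Representations of Unitary Groups in Three Variables* (1990): §4.9 Lemma 4.9.3 p. 56.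
-/

set_option autoImplicit false

noncomputable section

open MeasureTheory Measure Set NumberField IsDedekindDomain Matrix ValuativeRel MulAction Finset Polynomial
open scoped ValuativeRel Matrix MatrixGroups WithZero

namespace Literature.NumberTheory.Automorphic.UnitaryGroup

open Literature.NumberTheory.Rogawski1990 Literature.NumberTheory.Automorphic Literature.NumberTheory.Automorphic.IntegralReduction
open Literature.GroupTheory Literature.NumberTheory.GaloisRepresentations
open Literature.NumberTheory.Automorphic.UnitaryLatticeTree Literature.NumberTheory.Automorphic.HermitianLattice

variable (L : Type) [Field L] [NumberField L] [IsCMField L] (v : HeightOneSpectrum (𝓞 ↥(maximalRealSubfield L)))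
  (w : PlacesOver L v) (hw : IsCMField.complexConj L • w.1 = w.1)

/-! ## §0 Two generic lattice facts (datum-free) -/

/-- **A PLAIN LEVEL TOKEN AT ONE VERTEX BOUNDS THE CENTRE.**  Rank `2`, `|2| = 1`, `r ≠ 0`: if `(Γ − 1)·(g·𝒪²) ⊆ r·(g·𝒪²)` for some `g ∈ GL₂(K)`, then `|½tr Γ − 1| ≤ |r|` —
`r⁻¹·g⁻¹(Γ − 1)g` is integral (★ `forall_v_coe_conj_sub_smul_le_iff_map_le_scaleLattice`) and `tr(g⁻¹(Γ−1)g) = tr Γ − 2`. [cite: Kottwitz1986, §3] [cite: Rogawski1990, §4.9 p. 55] -/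
theorem _root_.Literature.NumberTheory.Automorphic.UnitaryLatticeTree.v_half_trace_sub_one_le_of_map_sub_one_le_scaleLattice {K : Type*} [Field K] [Valued K ℤᵐ⁰]
    {r : K} (hr : r ≠ 0) (h2 : Valued.v (2 : K) = 1) (Γ g : GL (Fin 2) K)
    (h : (mapGL g (stdLattice K 2)).map ((Matrix.toLin' ((Γ : Matrix (Fin 2) (Fin 2) K) - 1)).restrictScalars (Valued.integer K)) ≤ scaleLattice r (mapGL g (stdLattice K 2))) :
    Valued.v ((Γ : Matrix (Fin 2) (Fin 2) K).trace / 2 - 1) ≤ Valued.v r := by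
  have h20 : (2 : K) ≠ 0 := fun h0 => by rw [h0, map_zero] at h2; exact zero_ne_one h2
  have h1 : (mapGL g (stdLattice K 2)).map ((Matrix.toLin' ((Γ : Matrix (Fin 2) (Fin 2) K) - (1 : K) • (1 : Matrix (Fin 2) (Fin 2) K))).restrictScalars (Valued.integer K)) ≤
      scaleLattice r (mapGL g (stdLattice K 2)) := by rw [one_smul]; exact h
  have h' := (forall_v_coe_conj_sub_smul_le_iff_map_le_scaleLattice hr Γ g (1 : K)).2 h1
  simp only [one_smul] at h'
  have ht : (((g⁻¹ * Γ * g : GL (Fin 2) K)) : Matrix (Fin 2) (Fin 2) K).trace = (Γ : Matrix (Fin 2) (Fin 2) K).trace := by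
    rw [Units.val_mul, Units.val_mul, Matrix.trace_mul_cycle, ← Units.val_mul, mul_inv_cancel, Units.val_one, Matrix.one_mul]
  have e : (Γ : Matrix (Fin 2) (Fin 2) K).trace / 2 - 1 =
      (((((g⁻¹ * Γ * g : GL (Fin 2) K)) : Matrix (Fin 2) (Fin 2) K) - 1) 0 0 + ((((g⁻¹ * Γ * g : GL (Fin 2) K)) : Matrix (Fin 2) (Fin 2) K) - 1) 1 1) / 2 := by
    rw [← ht, Matrix.trace_fin_two, Matrix.sub_apply, Matrix.sub_apply, Matrix.one_apply_eq, Matrix.one_apply_eq]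
    field_simp
    ring
  rw [e, map_div₀, h2, div_one]
  exact (Valuation.map_add _ _ _).trans (max_le (h' 0 0) (h' 1 1))

/-- `ϖ^(k+1)·M ≤ ϖ^k·M` (`|ϖ| ≤ 1`). [cite: Serre1980Trees, Ch. II §1.1] -/
theorem _root_.Literature.NumberTheory.Automorphic.UnitaryLatticeTree.scaleLattice_pow_succ_le {K : Type*} [Field K] [Valued K ℤᵐ⁰] {N : ℕ} {ϖ : K} (hϖ1 : Valued.v ϖ ≤ 1)
    (M : Submodule (Valued.integer K) (Fin N → K)) (k : ℕ) : scaleLattice (ϖ ^ (k + 1)) M ≤ scaleLattice (ϖ ^ k) M := by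
  rw [pow_succ, ← scaleLattice_scaleLattice]
  exact scaleLattice_mono _ (scaleLattice_le_self_of_v_le_one hϖ1 M)

/-! ## §1 The plain balls at general depth, CM place -/

set_option maxHeartbeats 1600000 in
-- budget only: statement-heavy CM-place tokens (two currencies).
include hw in
/-- **THE PLAIN BALL OF RADIUS `ϖ^D`, EVEN DISCRIMINANT DEPTH.**  For a type-(2) `γ₂ ∈ U₂` (no root of `χ_{γ₂,w}` in `L_w`) with `|tr² − 4det|_w(γ_{2,w}) = exp(−2·2n)` at a
tame-ramified place, `Γ := e₂γ₂`, and a depth `D ≥ 1` with `D∕2 < n` and `|½trΓ − 1| ≤ |ϖ^D|` (automatic as soon as ONE fixed vertex carries the token, §0):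
`#{B ∣ SD, ΓB = B, (Γ − 1)B ⊆ ϖ^D B} = (q+1)·Σ_(k<n−D∕2) q^k` — the `sR.card` of the route-B block run on the hyperbolic literal (through ★ `ncard_selfDual_fixed_axis_lev_eq`).
PLAIN ⟺ CENTRED at radius `ϖ^D`; `D` even: ★ (B-i); `D` odd: the centred `ϖ^D`-ball is the centred `ϖ^(D−1)`-ball (★ (W3)∕(W1)), then ★ (B-i).
[cite: LabesseLanglands1979, §2 Lemma 2.1 p. 8] [cite: Kottwitz1986, §3] [cite: Rogawski1990, §4.9 Lemma 4.9.3 p. 56] -/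
theorem ncard_selfDual_fixed_lev_pow_eq_of_even_depth_ramified (he : v.asIdeal.ramificationIdx' w.1.asIdeal ≠ 1) (h2 : IsUnit (2 : 𝒪[(w.1.adicCompletion L)]))
    (ϖ : (w.1.adicCompletion L)ˣ) (hϖ : Valued.v (ϖ : (w.1.adicCompletion L)) = WithZero.exp (-1 : ℤ))
    (hσϖ : (galAdicCompletionMap (L := L) (IsCMField.complexConj L) hw) (ϖ : (w.1.adicCompletion L)) = -(ϖ : (w.1.adicCompletion L)))
    (γ₂ : ((cmDatum L 2 (Matrix.of fun i j : Fin 2 => if i.val + j.val + 1 = 2 then (1 : L) else 0)).Local v))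
    (hirr : ¬ ∃ x : (w.1.adicCompletion L), ((((((localNonsplitEquiv (IsCMField.complexConj L) (Matrix.of fun i j : Fin 2 => if i.val + j.val + 1 = 2 then (1 : L) else 0) (IsCMField.complexConj_ne_one L) w hw) γ₂ : ↥(unitaryGroupOfForm (galAdicCompletionMap (L := L) (IsCMField.complexConj L) hw) (placeForm (Matrix.of fun i j : Fin 2 => if i.val + j.val + 1 = 2 then (1 : L) else 0) w.1))) : GL (Fin 2) (w.1.adicCompletion L)) : Matrix (Fin 2) (Fin 2) (w.1.adicCompletion L))).charpoly).IsRoot x)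
    {n : ℕ} (hN : Valued.v ((((((localNonsplitEquiv (IsCMField.complexConj L) (Matrix.of fun i j : Fin 2 => if i.val + j.val + 1 = 2 then (1 : L) else 0) (IsCMField.complexConj_ne_one L) w hw) γ₂ : ↥(unitaryGroupOfForm (galAdicCompletionMap (L := L) (IsCMField.complexConj L) hw) (placeForm (Matrix.of fun i j : Fin 2 => if i.val + j.val + 1 = 2 then (1 : L) else 0) w.1))) : GL (Fin 2) (w.1.adicCompletion L)) : Matrix (Fin 2) (Fin 2) (w.1.adicCompletion L))).trace ^ 2 - 4 * (((((localNonsplitEquiv (IsCMField.complexConj L) (Matrix.of fun i j : Fin 2 => if i.val + j.val + 1 = 2 then (1 : L) else 0) (IsCMField.complexConj_ne_one L) w hw) γ₂ : ↥(unitaryGroupOfForm (galAdicCompletionMap (L := L) (IsCMField.complexConj L) hw) (placeForm (Matrix.of fun i j : Fin 2 => if i.val + j.val + 1 = 2 then (1 : L) else 0) w.1))) : GL (Fin 2) (w.1.adicCompletion L)) : Matrix (Fin 2) (Fin 2) (w.1.adicCompletion L))).det) = WithZero.exp (-((2 * (2 * n) : ℕ) : ℤ)))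
    {D : ℕ} (hD1 : 1 ≤ D) (hDn : D / 2 < n) (hcD : Valued.v ((((((localNonsplitEquiv (IsCMField.complexConj L) (Matrix.of fun i j : Fin 2 => if i.val + j.val + 1 = 2 then (1 : L) else 0) (IsCMField.complexConj_ne_one L) w hw) γ₂ : ↥(unitaryGroupOfForm (galAdicCompletionMap (L := L) (IsCMField.complexConj L) hw) (placeForm (Matrix.of fun i j : Fin 2 => if i.val + j.val + 1 = 2 then (1 : L) else 0) w.1))) : GL (Fin 2) (w.1.adicCompletion L)) : Matrix (Fin 2) (Fin 2) (w.1.adicCompletion L))).trace / 2 - 1) ≤ Valued.v ((ϖ : (w.1.adicCompletion L)) ^ D)) :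
    {B : Submodule (Valued.integer (w.1.adicCompletion L)) (Fin 2 → (w.1.adicCompletion L)) | IsSelfDualLattice (galAdicCompletionMap (L := L) (IsCMField.complexConj L) hw) (ϖ : (w.1.adicCompletion L)) (placeForm (Matrix.of fun i j : Fin 2 => if i.val + j.val + 1 = 2 then (1 : L) else 0) w.1) B ∧ mapGL (((localNonsplitEquiv (IsCMField.complexConj L) (Matrix.of fun i j : Fin 2 => if i.val + j.val + 1 = 2 then (1 : L) else 0) (IsCMField.complexConj_ne_one L) w hw) γ₂ : ↥(unitaryGroupOfForm (galAdicCompletionMap (L := L) (IsCMField.complexConj L) hw) (placeForm (Matrix.of fun i j : Fin 2 => if i.val + j.val + 1 = 2 then (1 : L) else 0) w.1))) : GL (Fin 2) (w.1.adicCompletion L)) B = B ∧ B.map ((Matrix.toLin' (((((localNonsplitEquiv (IsCMField.complexConj L) (Matrix.of fun i j : Fin 2 => if i.val + j.val + 1 = 2 then (1 : L) else 0) (IsCMField.complexConj_ne_one L) w hw) γ₂ : ↥(unitaryGroupOfForm (galAdicCompletionMap (L := L) (IsCMField.complexConj L) hw) (placeForm (Matrix.of fun i j : Fin 2 => if i.val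 + j.val + 1 = 2 then (1 : L) else 0) w.1))) : GL (Fin 2) (w.1.adicCompletion L)) : Matrix (Fin 2) (Fin 2) (w.1.adicCompletion L)) - 1)).restrictScalars (Valued.integer (w.1.adicCompletion L))) ≤ scaleLattice ((ϖ : (w.1.adicCompletion L)) ^ D) B}.ncard =
      ((Nat.card (𝓞 ↥(maximalRealSubfield L) ⧸ v.asIdeal)) + 1) * ∑ k ∈ Finset.range (n - D / 2), (Nat.card (𝓞 ↥(maximalRealSubfield L) ⧸ v.asIdeal)) ^ k := by
  have hc1 : IsCMField.complexConj L ≠ 1 := IsCMField.complexConj_ne_one L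
  have hσ : ∀ a, (galAdicCompletionMap (L := L) (IsCMField.complexConj L) hw) ((galAdicCompletionMap (L := L) (IsCMField.complexConj L) hw) a) = a := fun a =>
    Liu2021.galAdicCompletionMap_galAdicCompletionMap_self (↥(maximalRealSubfield L)) L (IsCMField.complexConj L)
      (AlgEquiv.ext fun x => IsCMField.complexConj_apply_apply L x) hw a
  have hvσ : ∀ a, Valued.v ((galAdicCompletionMap (L := L) (IsCMField.complexConj L) hw) a) = Valued.v a := fun a => valued_galAdicCompletionMap (L := L) (IsCMField.complexConj L) hw a
  have hres : ∀ x : (w.1.adicCompletion L), Valued.v x ≤ 1 → Valued.v ((galAdicCompletionMap (L := L) (IsCMField.complexConj L) hw) x - x) < 1 := fun x hx =>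
    Liu2021.LemD1IndexedNonVacuityRamifiedConverse.valued_galAdicCompletionMap_sub_lt_one_of_ramified L (IsCMField.complexConj L) v hc1 w hw he x hx
  have h2w : Valued.v (2 : (w.1.adicCompletion L)) = 1 := by
    have h := ((Valuation.integer.integers (ValuativeRel.valuation (w.1.adicCompletion L))).isUnit_iff_valuation_eq_one).1 h2
    exact (v_eq_one_iff_valuation_eq_one _).2 h
  have h20 : (2 : (w.1.adicCompletion L)) ≠ 0 := fun h0 => by rw [h0, map_zero] at h2w; exact zero_ne_one h2w
  have h40 : (4 : (w.1.adicCompletion L)) ≠ 0 := by rw [show (4 : (w.1.adicCompletion L)) = 2 * 2 by norm_num]; exact mul_ne_zero h20 h20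
  have hϖ0 : (ϖ : (w.1.adicCompletion L)) ≠ 0 := ϖ.ne_zero
  have hϖ1 : Valued.v (ϖ : (w.1.adicCompletion L)) ≤ 1 := by rw [hϖ, ← WithZero.exp_zero]; exact WithZero.exp_le_exp.2 (by norm_num)
  have hϖlt : Valued.v (ϖ : (w.1.adicCompletion L)) < 1 := by rw [hϖ, ← WithZero.exp_zero]; exact WithZero.exp_lt_exp.2 (by norm_num)
  have hH : (!![(0 : (w.1.adicCompletion L)), 1; 1, 0] : Matrix (Fin 2) (Fin 2) (w.1.adicCompletion L)) = placeForm (Matrix.of fun i j : Fin 2 => if i.val + j.val + 1 = 2 then (1 : L) else 0) w.1 := by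
    rw [placeForm_antidiagOne, stdForm_antidiagonal_two_over_eq]
  have hH₂ : ((placeForm (Matrix.of fun i j : Fin 2 => if i.val + j.val + 1 = 2 then (1 : L) else 0) w.1).map (galAdicCompletionMap (L := L) (IsCMField.complexConj L) hw))ᵀ = placeForm (Matrix.of fun i j : Fin 2 => if i.val + j.val + 1 = 2 then (1 : L) else 0) w.1 := by
    rw [← hH]
    ext i j
    fin_cases i <;> fin_cases j <;> simp
  have hγ : (((localNonsplitEquiv (IsCMField.complexConj L) (Matrix.of fun i j : Fin 2 => if i.val + j.val + 1 = 2 then (1 : L) else 0) (IsCMField.complexConj_ne_one L) w hw) γ₂ : ↥(unitaryGroupOfForm (galAdicCompletionMap (L := L) (IsCMField.complexConj L) hw) (placeForm (Matrix.of fun i j : Fin 2 => if i.val + j.val + 1 = 2 then (1 : L) else 0) w.1))) : GL (Fin 2) (w.1.adicCompletion L)) ∈ unitaryGroupOfForm (galAdicCompletionMap (L := L) (IsCMField.complexConj L) hw) (placeForm (Matrix.of fun i j : Fin 2 => if i.val + j.val + 1 = 2 then (1 : L) else 0) w.1) := (((localNonsplitEquiv (IsCMField.complexConj L) (Matrix.of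 fun i j : Fin 2 => if i.val + j.val + 1 = 2 then (1 : L) else 0) (IsCMField.complexConj_ne_one L) w hw) γ₂ : ↥(unitaryGroupOfForm (galAdicCompletionMap (L := L) (IsCMField.complexConj L) hw) (placeForm (Matrix.of fun i j : Fin 2 => if i.val + j.val + 1 = 2 then (1 : L) else 0) w.1)))).2
  have htr : (((((localNonsplitEquiv (IsCMField.complexConj L) (Matrix.of fun i j : Fin 2 => if i.val + j.val + 1 = 2 then (1 : L) else 0) (IsCMField.complexConj_ne_one L) w hw) γ₂ : ↥(unitaryGroupOfForm (galAdicCompletionMap (L := L) (IsCMField.complexConj L) hw) (placeForm (Matrix.of fun i j : Fin 2 => if i.val + j.val + 1 = 2 then (1 : L) else 0) w.1))) : GL (Fin 2) (w.1.adicCompletion L)) : Matrix (Fin 2) (Fin 2) (w.1.adicCompletion L))).trace = 2 * ((((((localNonsplitEquiv (IsCMField.complexConj L) (Matrix.of fun i j : Fin 2 => if i.val + j.val + 1 = 2 then (1 : L) else 0) (IsCMField.complexConj_ne_one L) w hw) γ₂ : ↥(unitaryGroupOfForm (galAdicCompletionMap (L := L) (IsCMField.complexConj L) hw) (placeForm (Matrix.of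 fun i j : Fin 2 => if i.val + j.val + 1 = 2 then (1 : L) else 0) w.1))) : GL (Fin 2) (w.1.adicCompletion L)) : Matrix (Fin 2) (Fin 2) (w.1.adicCompletion L))).trace / 2) := by rw [mul_comm, div_mul_cancel₀ _ h20]
  have e4 : ((((((localNonsplitEquiv (IsCMField.complexConj L) (Matrix.of fun i j : Fin 2 => if i.val + j.val + 1 = 2 then (1 : L) else 0) (IsCMField.complexConj_ne_one L) w hw) γ₂ : ↥(unitaryGroupOfForm (galAdicCompletionMap (L := L) (IsCMField.complexConj L) hw) (placeForm (Matrix.of fun i j : Fin 2 => if i.val + j.val + 1 = 2 then (1 : L) else 0) w.1))) : GL (Fin 2) (w.1.adicCompletion L)) : Matrix (Fin 2) (Fin 2) (w.1.adicCompletion L))).trace / 2) ^ 2 - (((((localNonsplitEquiv (IsCMField.complexConj L) (Matrix.of fun i j : Fin 2 => if i.val + j.val + 1 = 2 then (1 : L) else 0) (IsCMField.complexConj_ne_one L) w hw) γ₂ : ↥(unitaryGroupOfForm (galAdicCompletionMap (L := L) (IsCMField.complexConj L) hw) (placeForm (Matrix.of fun i j : Fin 2 => if i.val + j.val + 1 =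 2 then (1 : L) else 0) w.1))) : GL (Fin 2) (w.1.adicCompletion L)) : Matrix (Fin 2) (Fin 2) (w.1.adicCompletion L))).det = (((((((localNonsplitEquiv (IsCMField.complexConj L) (Matrix.of fun i j : Fin 2 => if i.val + j.val + 1 = 2 then (1 : L) else 0) (IsCMField.complexConj_ne_one L) w hw) γ₂ : ↥(unitaryGroupOfForm (galAdicCompletionMap (L := L) (IsCMField.complexConj L) hw) (placeForm (Matrix.of fun i j : Fin 2 => if i.val + j.val + 1 = 2 then (1 : L) else 0) w.1))) : GL (Fin 2) (w.1.adicCompletion L)) : Matrix (Fin 2) (Fin 2) (w.1.adicCompletion L))).trace ^ 2 - 4 * (((((localNonsplitEquiv (IsCMField.complexConj L) (Matrix.of fun i j : Fin 2 => if i.val + j.val + 1 = 2 then (1 : L) else 0) (IsCMField.complexConj_ne_one L) w hw) γ₂ : ↥(unitaryGroupOfForm (galAdicCompletionMap (L := L) (IsCMField.complexConj L) hw) (placeForm (Matrix.of fun i j : Fin 2 => if i.val + j.val + 1 = 2 then (1 : L) else 0) w.1))) : GL (Fin 2) (w.1.adicCompletion L)) : Matrix (Fin 2) (Fin 2) (w.1.adicCompletion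 L))).det)) / 4 := by
    field_simp
    ring
  have h4v : Valued.v (4 : (w.1.adicCompletion L)) = 1 := by rw [show (4 : (w.1.adicCompletion L)) = 2 * 2 by norm_num, map_mul, h2w, mul_one]
  -- `|c − 1| ≤ |ϖ^D| ≤ |ϖ| < 1`
  have hcDϖ : Valued.v ((((((localNonsplitEquiv (IsCMField.complexConj L) (Matrix.of fun i j : Fin 2 => if i.val + j.val + 1 = 2 then (1 : L) else 0) (IsCMField.complexConj_ne_one L) w hw) γ₂ : ↥(unitaryGroupOfForm (galAdicCompletionMap (L := L) (IsCMField.complexConj L) hw) (placeForm (Matrix.of fun i j : Fin 2 => if i.val + j.val + 1 = 2 then (1 : L) else 0) w.1))) : GL (Fin 2) (w.1.adicCompletion L)) : Matrix (Fin 2) (Fin 2) (w.1.adicCompletion L))).trace / 2 - 1) ≤ Valued.v (ϖ : (w.1.adicCompletion L)) := by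
    refine hcD.trans ?_
    rw [map_pow]
    exact pow_le_of_le_one zero_le hϖ1 (by omega)
  have hclt : Valued.v ((((((localNonsplitEquiv (IsCMField.complexConj L) (Matrix.of fun i j : Fin 2 => if i.val + j.val + 1 = 2 then (1 : L) else 0) (IsCMField.complexConj_ne_one L) w hw) γ₂ : ↥(unitaryGroupOfForm (galAdicCompletionMap (L := L) (IsCMField.complexConj L) hw) (placeForm (Matrix.of fun i j : Fin 2 => if i.val + j.val + 1 = 2 then (1 : L) else 0) w.1))) : GL (Fin 2) (w.1.adicCompletion L)) : Matrix (Fin 2) (Fin 2) (w.1.adicCompletion L))).trace / 2 - 1) < 1 := hcDϖ.trans_lt hϖlt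
  -- plain ↔ centred at radius `ϖ^D`
  have hset1 : {B : Submodule (Valued.integer (w.1.adicCompletion L)) (Fin 2 → (w.1.adicCompletion L)) | IsSelfDualLattice (galAdicCompletionMap (L := L) (IsCMField.complexConj L) hw) (ϖ : (w.1.adicCompletion L)) (placeForm (Matrix.of fun i j : Fin 2 => if i.val + j.val + 1 = 2 then (1 : L) else 0) w.1) B ∧ mapGL (((localNonsplitEquiv (IsCMField.complexConj L) (Matrix.of fun i j : Fin 2 => if i.val + j.val + 1 = 2 then (1 : L) else 0) (IsCMField.complexConj_ne_one L) w hw) γ₂ : ↥(unitaryGroupOfForm (galAdicCompletionMap (L := L) (IsCMField.complexConj L) hw) (placeForm (Matrix.of fun i j : Fin 2 => if i.val + j.val + 1 = 2 then (1 : L) else 0) w.1))) : GL (Fin 2) (w.1.adicCompletion L)) B = B ∧ B.map ((Matrix.toLin' (((((localNonsplitEquiv (IsCMField.complexConj L) (Matrix.of fun i j : Fin 2 => if i.val + j.val + 1 = 2 then (1 : L) else 0) (IsCMField.complexConj_ne_one L) w hw) γ₂ : ↥(unitaryGroupOfForm (galAdicCompletionMap (L := L) (IsCMField.complexConj L) hw)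 (placeForm (Matrix.of fun i j : Fin 2 => if i.val + j.val + 1 = 2 then (1 : L) else 0) w.1))) : GL (Fin 2) (w.1.adicCompletion L)) : Matrix (Fin 2) (Fin 2) (w.1.adicCompletion L)) - 1)).restrictScalars (Valued.integer (w.1.adicCompletion L))) ≤ scaleLattice ((ϖ : (w.1.adicCompletion L)) ^ D) B} =
      {B : Submodule (Valued.integer (w.1.adicCompletion L)) (Fin 2 → (w.1.adicCompletion L)) | IsSelfDualLattice (galAdicCompletionMap (L := L) (IsCMField.complexConj L) hw) (ϖ : (w.1.adicCompletion L)) (placeForm (Matrix.of fun i j : Fin 2 => if i.val + j.val + 1 = 2 then (1 : L) else 0) w.1) B ∧ mapGL (((localNonsplitEquiv (IsCMField.complexConj L) (Matrix.of fun i j : Fin 2 => if i.val + j.val + 1 = 2 then (1 : L) else 0) (IsCMField.complexConj_ne_one L) w hw) γ₂ : ↥(unitaryGroupOfForm (galAdicCompletionMap (L := L) (IsCMField.complexConj L) hw) (placeForm (Matrix.of fun i j : Fin 2 => if i.val + j.val + 1 = 2 then (1 : L) else 0) w.1))) : GL (Fin 2) (w.1.adicCompletion L)) B = B ∧ B.map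 ((Matrix.toLin' (((((localNonsplitEquiv (IsCMField.complexConj L) (Matrix.of fun i j : Fin 2 => if i.val + j.val + 1 = 2 then (1 : L) else 0) (IsCMField.complexConj_ne_one L) w hw) γ₂ : ↥(unitaryGroupOfForm (galAdicCompletionMap (L := L) (IsCMField.complexConj L) hw) (placeForm (Matrix.of fun i j : Fin 2 => if i.val + j.val + 1 = 2 then (1 : L) else 0) w.1))) : GL (Fin 2) (w.1.adicCompletion L)) : Matrix (Fin 2) (Fin 2) (w.1.adicCompletion L)) - ((((((localNonsplitEquiv (IsCMField.complexConj L) (Matrix.of fun i j : Fin 2 => if i.val + j.val + 1 = 2 then (1 : L) else 0) (IsCMField.complexConj_ne_one L) w hw) γ₂ : ↥(unitaryGroupOfForm (galAdicCompletionMap (L := L) (IsCMField.complexConj L) hw) (placeForm (Matrix.of fun i j : Fin 2 => if i.val + j.val + 1 = 2 then (1 : L) else 0) w.1))) : GL (Fin 2) (w.1.adicCompletion L)) : Matrix (Fin 2) (Fin 2) (w.1.adicCompletion L))).trace / 2) • (1 : Matrix (Fin 2) (Fin 2) (w.1.adicCompletion L)))).restrictScalars (Valued.integer (w.1.adicCompletion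 L))) ≤ scaleLattice ((ϖ : (w.1.adicCompletion L)) ^ D) B} :=
    Set.ext fun B => and_congr_right fun _ => and_congr_right fun _ =>
      (map_sub_smul_one_le_scaleLattice_iff_map_sub_one_le (((((localNonsplitEquiv (IsCMField.complexConj L) (Matrix.of fun i j : Fin 2 => if i.val + j.val + 1 = 2 then (1 : L) else 0) (IsCMField.complexConj_ne_one L) w hw) γ₂ : ↥(unitaryGroupOfForm (galAdicCompletionMap (L := L) (IsCMField.complexConj L) hw) (placeForm (Matrix.of fun i j : Fin 2 => if i.val + j.val + 1 = 2 then (1 : L) else 0) w.1))) : GL (Fin 2) (w.1.adicCompletion L)) : Matrix (Fin 2) (Fin 2) (w.1.adicCompletion L))) (pow_ne_zero D hϖ0) hcD B).symm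
  rw [hset1]
  obtain ⟨j, hj | hj⟩ := Nat.even_or_odd' D
  · subst hj
    rw [Nat.mul_div_cancel_left j two_pos] at hDn ⊢
    exact ncard_selfDual_fixed_centredBall_eq_of_even_depth_ramified L v w hw he h2 ϖ hϖ hσϖ γ₂ hirr hN hDn
  · subst hj
    rw [show (2 * j + 1) / 2 = j by omega] at hDn ⊢
    -- «odd scales are free»: the centred ball of radius `ϖ^(2j+1)` is the centred ball of radius `ϖ^(2j)`
    have hset2 : {B : Submodule (Valued.integer (w.1.adicCompletion L)) (Fin 2 → (w.1.adicCompletion L)) | IsSelfDualLattice (galAdicCompletionMap (L := L) (IsCMField.complexConj L) hw) (ϖ : (w.1.adicCompletion L)) (placeForm (Matrix.of fun i j : Fin 2 => if i.val + j.val + 1 = 2 then (1 : L) else 0) w.1) B ∧ mapGL (((localNonsplitEquiv (IsCMField.complexConj L) (Matrix.of fun i j : Fin 2 => if i.val + j.val + 1 = 2 then (1 : L) else 0) (IsCMField.complexConj_ne_one L) w hw) γ₂ : ↥(unitaryGroupOfForm (galAdicCompletionMap (L := L) (IsCMField.complexConj L) hw) (placeForm (Matrix.of fun i j : Fin 2 =>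 if i.val + j.val + 1 = 2 then (1 : L) else 0) w.1))) : GL (Fin 2) (w.1.adicCompletion L)) B = B ∧ B.map ((Matrix.toLin' (((((localNonsplitEquiv (IsCMField.complexConj L) (Matrix.of fun i j : Fin 2 => if i.val + j.val + 1 = 2 then (1 : L) else 0) (IsCMField.complexConj_ne_one L) w hw) γ₂ : ↥(unitaryGroupOfForm (galAdicCompletionMap (L := L) (IsCMField.complexConj L) hw) (placeForm (Matrix.of fun i j : Fin 2 => if i.val + j.val + 1 = 2 then (1 : L) else 0) w.1))) : GL (Fin 2) (w.1.adicCompletion L)) : Matrix (Fin 2) (Fin 2) (w.1.adicCompletion L)) - ((((((localNonsplitEquiv (IsCMField.complexConj L) (Matrix.of fun i j : Fin 2 => if i.val + j.val + 1 = 2 then (1 : L) else 0) (IsCMField.complexConj_ne_one L) w hw) γ₂ : ↥(unitaryGroupOfForm (galAdicCompletionMap (L := L) (IsCMField.complexConj L) hw) (placeForm (Matrix.of fun i j : Fin 2 => if i.val + j.val + 1 = 2 then (1 : L) else 0) w.1))) : GL (Fin 2) (w.1.adicCompletion L)) : Matrix (Fin 2) (Fin 2) (w.1.adicCompletion L))).trace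 / 2) • (1 : Matrix (Fin 2) (Fin 2) (w.1.adicCompletion L)))).restrictScalars (Valued.integer (w.1.adicCompletion L))) ≤ scaleLattice ((ϖ : (w.1.adicCompletion L)) ^ (2 * j + 1)) B} =
        {B : Submodule (Valued.integer (w.1.adicCompletion L)) (Fin 2 → (w.1.adicCompletion L)) | IsSelfDualLattice (galAdicCompletionMap (L := L) (IsCMField.complexConj L) hw) (ϖ : (w.1.adicCompletion L)) (placeForm (Matrix.of fun i j : Fin 2 => if i.val + j.val + 1 = 2 then (1 : L) else 0) w.1) B ∧ mapGL (((localNonsplitEquiv (IsCMField.complexConj L) (Matrix.of fun i j : Fin 2 => if i.val + j.val + 1 = 2 then (1 : L) else 0) (IsCMField.complexConj_ne_one L) w hw) γ₂ : ↥(unitaryGroupOfForm (galAdicCompletionMap (L := L) (IsCMField.complexConj L) hw) (placeForm (Matrix.of fun i j : Fin 2 => if i.val + j.val + 1 = 2 then (1 : L) else 0) w.1))) : GL (Fin 2) (w.1.adicCompletion L)) B = B ∧ B.map ((Matrix.toLin' (((((localNonsplitEquiv (IsCMField.complexConj L) (Matrix.of fun i j : Fin 2 => if i.val + j.val + 1 =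 2 then (1 : L) else 0) (IsCMField.complexConj_ne_one L) w hw) γ₂ : ↥(unitaryGroupOfForm (galAdicCompletionMap (L := L) (IsCMField.complexConj L) hw) (placeForm (Matrix.of fun i j : Fin 2 => if i.val + j.val + 1 = 2 then (1 : L) else 0) w.1))) : GL (Fin 2) (w.1.adicCompletion L)) : Matrix (Fin 2) (Fin 2) (w.1.adicCompletion L)) - ((((((localNonsplitEquiv (IsCMField.complexConj L) (Matrix.of fun i j : Fin 2 => if i.val + j.val + 1 = 2 then (1 : L) else 0) (IsCMField.complexConj_ne_one L) w hw) γ₂ : ↥(unitaryGroupOfForm (galAdicCompletionMap (L := L) (IsCMField.complexConj L) hw) (placeForm (Matrix.of fun i j : Fin 2 => if i.val + j.val + 1 = 2 then (1 : L) else 0) w.1))) : GL (Fin 2) (w.1.adicCompletion L)) : Matrix (Fin 2) (Fin 2) (w.1.adicCompletion L))).trace / 2) • (1 : Matrix (Fin 2) (Fin 2) (w.1.adicCompletion L)))).restrictScalars (Valued.integer (w.1.adicCompletion L))) ≤ scaleLattice ((ϖ : (w.1.adicCompletion L)) ^ (2 * j)) B} := by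
      ext B
      simp only [Set.mem_setOf_eq]
      refine ⟨fun h => ⟨h.1, h.2.1, h.2.2.trans (scaleLattice_pow_succ_le hϖ1 B (2 * j))⟩, fun h => ⟨h.1, h.2.1, ?_⟩⟩
      rcases Nat.eq_zero_or_pos j with rfl | hj1
      · -- `j = 0`: every fixed self-dual `B` has PLAIN `LEV(ϖ)` (★ (W1)), hence centred `LEV(ϖ)` (`|c − 1| ≤ |ϖ|`)
        have hD1' : Valued.v (((((((localNonsplitEquiv (IsCMField.complexConj L) (Matrix.of fun i j : Fin 2 => if i.val + j.val + 1 = 2 then (1 : L) else 0) (IsCMField.complexConj_ne_one L) w hw) γ₂ : ↥(unitaryGroupOfForm (galAdicCompletionMap (L := L) (IsCMField.complexConj L) hw) (placeForm (Matrix.of fun i j : Fin 2 => if i.val + j.val + 1 = 2 then (1 : L) else 0) w.1))) : GL (Fin 2) (w.1.adicCompletion L)) : Matrix (Fin 2) (Fin 2) (w.1.adicCompletion L))).trace / 2) ^ 2 - (((((localNonsplitEquiv (IsCMField.complexConj L) (Matrix.of fun i j : Fin 2 => if i.val + j.val + 1 = 2 then (1 : L) else 0) (IsCMField.complexConj_ne_one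 L) w hw) γ₂ : ↥(unitaryGroupOfForm (galAdicCompletionMap (L := L) (IsCMField.complexConj L) hw) (placeForm (Matrix.of fun i j : Fin 2 => if i.val + j.val + 1 = 2 then (1 : L) else 0) w.1))) : GL (Fin 2) (w.1.adicCompletion L)) : Matrix (Fin 2) (Fin 2) (w.1.adicCompletion L))).det) < 1 := by
          rw [e4, map_div₀, h4v, div_one, hN, ← WithZero.exp_zero]
          exact WithZero.exp_lt_exp.2 (by omega)
        have hplain := map_sub_one_le_scaleLattice_of_fixed_selfDual_two hσ hϖ hres h2w hH₂ hγ htr hclt hD1' h.1 h.2.1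
        rw [Nat.mul_zero, zero_add, pow_one]
        exact (map_sub_smul_one_le_scaleLattice_iff_map_sub_one_le (((((localNonsplitEquiv (IsCMField.complexConj L) (Matrix.of fun i j : Fin 2 => if i.val + j.val + 1 = 2 then (1 : L) else 0) (IsCMField.complexConj_ne_one L) w hw) γ₂ : ↥(unitaryGroupOfForm (galAdicCompletionMap (L := L) (IsCMField.complexConj L) hw) (placeForm (Matrix.of fun i j : Fin 2 => if i.val + j.val + 1 = 2 then (1 : L) else 0) w.1))) : GL (Fin 2) (w.1.adicCompletion L)) : Matrix (Fin 2) (Fin 2) (w.1.adicCompletion L))) hϖ0 hcDϖ B).2 hplain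
      · have hDisc : Valued.v (((((((localNonsplitEquiv (IsCMField.complexConj L) (Matrix.of fun i j : Fin 2 => if i.val + j.val + 1 = 2 then (1 : L) else 0) (IsCMField.complexConj_ne_one L) w hw) γ₂ : ↥(unitaryGroupOfForm (galAdicCompletionMap (L := L) (IsCMField.complexConj L) hw) (placeForm (Matrix.of fun i j : Fin 2 => if i.val + j.val + 1 = 2 then (1 : L) else 0) w.1))) : GL (Fin 2) (w.1.adicCompletion L)) : Matrix (Fin 2) (Fin 2) (w.1.adicCompletion L))).trace / 2) ^ 2 - (((((localNonsplitEquiv (IsCMField.complexConj L) (Matrix.of fun i j : Fin 2 => if i.val + j.val + 1 = 2 then (1 : L) else 0) (IsCMField.complexConj_ne_one L) w hw) γ₂ : ↥(unitaryGroupOfForm (galAdicCompletionMap (L := L) (IsCMField.complexConj L) hw) (placeForm (Matrix.of fun i j : Fin 2 => if i.val + j.val + 1 = 2 then (1 : L) else 0) w.1))) : GL (Fin 2) (w.1.adicCompletion L)) : Matrix (Fin 2) (Fin 2) (w.1.adicCompletion L))).det) < Valued.v (ϖ : (w.1.adicCompletion L)) ^ (2 * (2 * j)) := by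
          rw [e4, map_div₀, h4v, div_one, hN, hϖ, ← WithZero.exp_nsmul, WithZero.exp_lt_exp]
          simp only [nsmul_eq_mul]
          omega
        exact map_sub_smul_one_le_scaleLattice_succ_of_even_two hσ hvσ hσϖ hϖ hres h2w hH₂ hγ htr hclt h.1 h.2.1 (even_two_mul j) (by omega) hDisc h.2.2
    rw [hset2]
    exact ncard_selfDual_fixed_centredBall_eq_of_even_depth_ramified L v w hw he h2 ϖ hϖ hσϖ γ₂ hirr hN hDn

set_option maxHeartbeats 1600000 in
-- budget only: statement-heavy CM-place tokens (two currencies).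
include hw in
/-- **THE PLAIN BALL OF RADIUS `ϖ^D`, ODD DISCRIMINANT DEPTH.**  For a type-(2) `γ₂ ∈ U₂` with `|tr² − 4det|_w(γ_{2,w}) = exp(−2(2n+1))` at a tame-ramified place, `Γ := e₂γ₂`,
and a depth `D ≥ 1` with `D∕2 ≤ n` and `|½trΓ − 1| ≤ |ϖ^D|`: `#{B ∣ SD, ΓB = B, (Γ − 1)B ⊆ ϖ^D B} + 1 = 2·Σ_(k<n−D∕2+1) q^k` (the odd twin: ★ (B-i) odd edge balls).
[cite: LabesseLanglands1979, §2 Lemma 2.1 p. 8] [cite: Kottwitz1986, §3] [cite: Rogawski1990, §4.9 Lemma 4.9.3 p. 56] -/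
theorem ncard_selfDual_fixed_lev_pow_eq_of_odd_depth_ramified (he : v.asIdeal.ramificationIdx' w.1.asIdeal ≠ 1) (h2 : IsUnit (2 : 𝒪[(w.1.adicCompletion L)]))
    (ϖ : (w.1.adicCompletion L)ˣ) (hϖ : Valued.v (ϖ : (w.1.adicCompletion L)) = WithZero.exp (-1 : ℤ))
    (hσϖ : (galAdicCompletionMap (L := L) (IsCMField.complexConj L) hw) (ϖ : (w.1.adicCompletion L)) = -(ϖ : (w.1.adicCompletion L)))
    (γ₂ : ((cmDatum L 2 (Matrix.of fun i j : Fin 2 => if i.val + j.val + 1 = 2 then (1 : L) else 0)).Local v))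
    (hirr : ¬ ∃ x : (w.1.adicCompletion L), ((((((localNonsplitEquiv (IsCMField.complexConj L) (Matrix.of fun i j : Fin 2 => if i.val + j.val + 1 = 2 then (1 : L) else 0) (IsCMField.complexConj_ne_one L) w hw) γ₂ : ↥(unitaryGroupOfForm (galAdicCompletionMap (L := L) (IsCMField.complexConj L) hw) (placeForm (Matrix.of fun i j : Fin 2 => if i.val + j.val + 1 = 2 then (1 : L) else 0) w.1))) : GL (Fin 2) (w.1.adicCompletion L)) : Matrix (Fin 2) (Fin 2) (w.1.adicCompletion L))).charpoly).IsRoot x)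
    {n : ℕ} (hN : Valued.v ((((((localNonsplitEquiv (IsCMField.complexConj L) (Matrix.of fun i j : Fin 2 => if i.val + j.val + 1 = 2 then (1 : L) else 0) (IsCMField.complexConj_ne_one L) w hw) γ₂ : ↥(unitaryGroupOfForm (galAdicCompletionMap (L := L) (IsCMField.complexConj L) hw) (placeForm (Matrix.of fun i j : Fin 2 => if i.val + j.val + 1 = 2 then (1 : L) else 0) w.1))) : GL (Fin 2) (w.1.adicCompletion L)) : Matrix (Fin 2) (Fin 2) (w.1.adicCompletion L))).trace ^ 2 - 4 * (((((localNonsplitEquiv (IsCMField.complexConj L) (Matrix.of fun i j : Fin 2 => if i.val + j.val + 1 = 2 then (1 : L) else 0) (IsCMField.complexConj_ne_one L) w hw) γ₂ : ↥(unitaryGroupOfForm (galAdicCompletionMap (L := L) (IsCMField.complexConj L) hw) (placeForm (Matrix.of fun i j : Fin 2 => if i.val + j.val + 1 = 2 then (1 : L) else 0) w.1))) : GL (Fin 2) (w.1.adicCompletion L)) : Matrix (Fin 2) (Fin 2) (w.1.adicCompletion L))).det) = WithZero.exp (-((2 * (2 * n + 1) : ℕ) : ℤ)))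
    {D : ℕ} (hD1 : 1 ≤ D) (hDn : D / 2 ≤ n) (hcD : Valued.v ((((((localNonsplitEquiv (IsCMField.complexConj L) (Matrix.of fun i j : Fin 2 => if i.val + j.val + 1 = 2 then (1 : L) else 0) (IsCMField.complexConj_ne_one L) w hw) γ₂ : ↥(unitaryGroupOfForm (galAdicCompletionMap (L := L) (IsCMField.complexConj L) hw) (placeForm (Matrix.of fun i j : Fin 2 => if i.val + j.val + 1 = 2 then (1 : L) else 0) w.1))) : GL (Fin 2) (w.1.adicCompletion L)) : Matrix (Fin 2) (Fin 2) (w.1.adicCompletion L))).trace / 2 - 1) ≤ Valued.v ((ϖ : (w.1.adicCompletion L)) ^ D)) :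
    {B : Submodule (Valued.integer (w.1.adicCompletion L)) (Fin 2 → (w.1.adicCompletion L)) | IsSelfDualLattice (galAdicCompletionMap (L := L) (IsCMField.complexConj L) hw) (ϖ : (w.1.adicCompletion L)) (placeForm (Matrix.of fun i j : Fin 2 => if i.val + j.val + 1 = 2 then (1 : L) else 0) w.1) B ∧ mapGL (((localNonsplitEquiv (IsCMField.complexConj L) (Matrix.of fun i j : Fin 2 => if i.val + j.val + 1 = 2 then (1 : L) else 0) (IsCMField.complexConj_ne_one L) w hw) γ₂ : ↥(unitaryGroupOfForm (galAdicCompletionMap (L := L) (IsCMField.complexConj L) hw) (placeForm (Matrix.of fun i j : Fin 2 => if i.val + j.val + 1 = 2 then (1 : L) else 0) w.1))) : GL (Fin 2) (w.1.adicCompletion L)) B = B ∧ B.map ((Matrix.toLin' (((((localNonsplitEquiv (IsCMField.complexConj L) (Matrix.of fun i j : Fin 2 => if i.val + j.val + 1 = 2 then (1 : L) else 0) (IsCMField.complexConj_ne_one L) w hw) γ₂ : ↥(unitaryGroupOfForm (galAdicCompletionMap (L := L) (IsCMField.complexConj L) hw) (placeForm (Matrix.of fun i j : Fin 2 => if i.val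 + j.val + 1 = 2 then (1 : L) else 0) w.1))) : GL (Fin 2) (w.1.adicCompletion L)) : Matrix (Fin 2) (Fin 2) (w.1.adicCompletion L)) - 1)).restrictScalars (Valued.integer (w.1.adicCompletion L))) ≤ scaleLattice ((ϖ : (w.1.adicCompletion L)) ^ D) B}.ncard + 1 =
      2 * ∑ k ∈ Finset.range (n - D / 2 + 1), (Nat.card (𝓞 ↥(maximalRealSubfield L) ⧸ v.asIdeal)) ^ k := by
  have hc1 : IsCMField.complexConj L ≠ 1 := IsCMField.complexConj_ne_one L
  have hσ : ∀ a, (galAdicCompletionMap (L := L) (IsCMField.complexConj L) hw) ((galAdicCompletionMap (L := L) (IsCMField.complexConj L) hw) a) = a := fun a =>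
    Liu2021.galAdicCompletionMap_galAdicCompletionMap_self (↥(maximalRealSubfield L)) L (IsCMField.complexConj L)
      (AlgEquiv.ext fun x => IsCMField.complexConj_apply_apply L x) hw a
  have hvσ : ∀ a, Valued.v ((galAdicCompletionMap (L := L) (IsCMField.complexConj L) hw) a) = Valued.v a := fun a => valued_galAdicCompletionMap (L := L) (IsCMField.complexConj L) hw a
  have hres : ∀ x : (w.1.adicCompletion L), Valued.v x ≤ 1 → Valued.v ((galAdicCompletionMap (L := L) (IsCMField.complexConj L) hw) x - x) < 1 := fun x hx =>
    Liu2021.LemD1IndexedNonVacuityRamifiedConverse.valued_galAdicCompletionMap_sub_lt_one_of_ramified L (IsCMField.complexConj L) v hc1 w hw he x hx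
  have h2w : Valued.v (2 : (w.1.adicCompletion L)) = 1 := by
    have h := ((Valuation.integer.integers (ValuativeRel.valuation (w.1.adicCompletion L))).isUnit_iff_valuation_eq_one).1 h2
    exact (v_eq_one_iff_valuation_eq_one _).2 h
  have h20 : (2 : (w.1.adicCompletion L)) ≠ 0 := fun h0 => by rw [h0, map_zero] at h2w; exact zero_ne_one h2w
  have h40 : (4 : (w.1.adicCompletion L)) ≠ 0 := by rw [show (4 : (w.1.adicCompletion L)) = 2 * 2 by norm_num]; exact mul_ne_zero h20 h20
  have hϖ0 : (ϖ : (w.1.adicCompletion L)) ≠ 0 := ϖ.ne_zero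
  have hϖ1 : Valued.v (ϖ : (w.1.adicCompletion L)) ≤ 1 := by rw [hϖ, ← WithZero.exp_zero]; exact WithZero.exp_le_exp.2 (by norm_num)
  have hϖlt : Valued.v (ϖ : (w.1.adicCompletion L)) < 1 := by rw [hϖ, ← WithZero.exp_zero]; exact WithZero.exp_lt_exp.2 (by norm_num)
  have hH : (!![(0 : (w.1.adicCompletion L)), 1; 1, 0] : Matrix (Fin 2) (Fin 2) (w.1.adicCompletion L)) = placeForm (Matrix.of fun i j : Fin 2 => if i.val + j.val + 1 = 2 then (1 : L) else 0) w.1 := by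
    rw [placeForm_antidiagOne, stdForm_antidiagonal_two_over_eq]
  have hH₂ : ((placeForm (Matrix.of fun i j : Fin 2 => if i.val + j.val + 1 = 2 then (1 : L) else 0) w.1).map (galAdicCompletionMap (L := L) (IsCMField.complexConj L) hw))ᵀ = placeForm (Matrix.of fun i j : Fin 2 => if i.val + j.val + 1 = 2 then (1 : L) else 0) w.1 := by
    rw [← hH]
    ext i j
    fin_cases i <;> fin_cases j <;> simp
  have hγ : (((localNonsplitEquiv (IsCMField.complexConj L) (Matrix.of fun i j : Fin 2 => if i.val + j.val + 1 = 2 then (1 : L) else 0) (IsCMField.complexConj_ne_one L) w hw) γ₂ : ↥(unitaryGroupOfForm (galAdicCompletionMap (L := L) (IsCMField.complexConj L) hw) (placeForm (Matrix.of fun i j : Fin 2 => if i.val + j.val + 1 = 2 then (1 : L) else 0) w.1))) : GL (Fin 2) (w.1.adicCompletion L)) ∈ unitaryGroupOfForm (galAdicCompletionMap (L := L) (IsCMField.complexConj L) hw) (placeForm (Matrix.of fun i j : Fin 2 => if i.val + j.val + 1 = 2 then (1 : L) else 0) w.1) := (((localNonsplitEquiv (IsCMField.complexConj L) (Matrix.of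 fun i j : Fin 2 => if i.val + j.val + 1 = 2 then (1 : L) else 0) (IsCMField.complexConj_ne_one L) w hw) γ₂ : ↥(unitaryGroupOfForm (galAdicCompletionMap (L := L) (IsCMField.complexConj L) hw) (placeForm (Matrix.of fun i j : Fin 2 => if i.val + j.val + 1 = 2 then (1 : L) else 0) w.1)))).2
  have htr : (((((localNonsplitEquiv (IsCMField.complexConj L) (Matrix.of fun i j : Fin 2 => if i.val + j.val + 1 = 2 then (1 : L) else 0) (IsCMField.complexConj_ne_one L) w hw) γ₂ : ↥(unitaryGroupOfForm (galAdicCompletionMap (L := L) (IsCMField.complexConj L) hw) (placeForm (Matrix.of fun i j : Fin 2 => if i.val + j.val + 1 = 2 then (1 : L) else 0) w.1))) : GL (Fin 2) (w.1.adicCompletion L)) : Matrix (Fin 2) (Fin 2) (w.1.adicCompletion L))).trace = 2 * ((((((localNonsplitEquiv (IsCMField.complexConj L) (Matrix.of fun i j : Fin 2 => if i.val + j.val + 1 = 2 then (1 : L) else 0) (IsCMField.complexConj_ne_one L) w hw) γ₂ : ↥(unitaryGroupOfForm (galAdicCompletionMap (L := L) (IsCMField.complexConj L) hw) (placeForm (Matrix.of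 fun i j : Fin 2 => if i.val + j.val + 1 = 2 then (1 : L) else 0) w.1))) : GL (Fin 2) (w.1.adicCompletion L)) : Matrix (Fin 2) (Fin 2) (w.1.adicCompletion L))).trace / 2) := by rw [mul_comm, div_mul_cancel₀ _ h20]
  have e4 : ((((((localNonsplitEquiv (IsCMField.complexConj L) (Matrix.of fun i j : Fin 2 => if i.val + j.val + 1 = 2 then (1 : L) else 0) (IsCMField.complexConj_ne_one L) w hw) γ₂ : ↥(unitaryGroupOfForm (galAdicCompletionMap (L := L) (IsCMField.complexConj L) hw) (placeForm (Matrix.of fun i j : Fin 2 => if i.val + j.val + 1 = 2 then (1 : L) else 0) w.1))) : GL (Fin 2) (w.1.adicCompletion L)) : Matrix (Fin 2) (Fin 2) (w.1.adicCompletion L))).trace / 2) ^ 2 - (((((localNonsplitEquiv (IsCMField.complexConj L) (Matrix.of fun i j : Fin 2 => if i.val + j.val + 1 = 2 then (1 : L) else 0) (IsCMField.complexConj_ne_one L) w hw) γ₂ : ↥(unitaryGroupOfForm (galAdicCompletionMap (L := L) (IsCMField.complexConj L) hw) (placeForm (Matrix.of fun i j : Fin 2 => if i.val + j.val + 1 =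 2 then (1 : L) else 0) w.1))) : GL (Fin 2) (w.1.adicCompletion L)) : Matrix (Fin 2) (Fin 2) (w.1.adicCompletion L))).det = (((((((localNonsplitEquiv (IsCMField.complexConj L) (Matrix.of fun i j : Fin 2 => if i.val + j.val + 1 = 2 then (1 : L) else 0) (IsCMField.complexConj_ne_one L) w hw) γ₂ : ↥(unitaryGroupOfForm (galAdicCompletionMap (L := L) (IsCMField.complexConj L) hw) (placeForm (Matrix.of fun i j : Fin 2 => if i.val + j.val + 1 = 2 then (1 : L) else 0) w.1))) : GL (Fin 2) (w.1.adicCompletion L)) : Matrix (Fin 2) (Fin 2) (w.1.adicCompletion L))).trace ^ 2 - 4 * (((((localNonsplitEquiv (IsCMField.complexConj L) (Matrix.of fun i j : Fin 2 => if i.val + j.val + 1 = 2 then (1 : L) else 0) (IsCMField.complexConj_ne_one L) w hw) γ₂ : ↥(unitaryGroupOfForm (galAdicCompletionMap (L := L) (IsCMField.complexConj L) hw) (placeForm (Matrix.of fun i j : Fin 2 => if i.val + j.val + 1 = 2 then (1 : L) else 0) w.1))) : GL (Fin 2) (w.1.adicCompletion L)) : Matrix (Fin 2) (Fin 2) (w.1.adicCompletion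 L))).det)) / 4 := by
    field_simp
    ring
  have h4v : Valued.v (4 : (w.1.adicCompletion L)) = 1 := by rw [show (4 : (w.1.adicCompletion L)) = 2 * 2 by norm_num, map_mul, h2w, mul_one]
  -- `|c − 1| ≤ |ϖ^D| ≤ |ϖ| < 1`
  have hcDϖ : Valued.v ((((((localNonsplitEquiv (IsCMField.complexConj L) (Matrix.of fun i j : Fin 2 => if i.val + j.val + 1 = 2 then (1 : L) else 0) (IsCMField.complexConj_ne_one L) w hw) γ₂ : ↥(unitaryGroupOfForm (galAdicCompletionMap (L := L) (IsCMField.complexConj L) hw) (placeForm (Matrix.of fun i j : Fin 2 => if i.val + j.val + 1 = 2 then (1 : L) else 0) w.1))) : GL (Fin 2) (w.1.adicCompletion L)) : Matrix (Fin 2) (Fin 2) (w.1.adicCompletion L))).trace / 2 - 1) ≤ Valued.v (ϖ : (w.1.adicCompletion L)) := by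
    refine hcD.trans ?_
    rw [map_pow]
    exact pow_le_of_le_one zero_le hϖ1 (by omega)
  have hclt : Valued.v ((((((localNonsplitEquiv (IsCMField.complexConj L) (Matrix.of fun i j : Fin 2 => if i.val + j.val + 1 = 2 then (1 : L) else 0) (IsCMField.complexConj_ne_one L) w hw) γ₂ : ↥(unitaryGroupOfForm (galAdicCompletionMap (L := L) (IsCMField.complexConj L) hw) (placeForm (Matrix.of fun i j : Fin 2 => if i.val + j.val + 1 = 2 then (1 : L) else 0) w.1))) : GL (Fin 2) (w.1.adicCompletion L)) : Matrix (Fin 2) (Fin 2) (w.1.adicCompletion L))).trace / 2 - 1) < 1 := hcDϖ.trans_lt hϖlt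
  -- plain ↔ centred at radius `ϖ^D`
  have hset1 : {B : Submodule (Valued.integer (w.1.adicCompletion L)) (Fin 2 → (w.1.adicCompletion L)) | IsSelfDualLattice (galAdicCompletionMap (L := L) (IsCMField.complexConj L) hw) (ϖ : (w.1.adicCompletion L)) (placeForm (Matrix.of fun i j : Fin 2 => if i.val + j.val + 1 = 2 then (1 : L) else 0) w.1) B ∧ mapGL (((localNonsplitEquiv (IsCMField.complexConj L) (Matrix.of fun i j : Fin 2 => if i.val + j.val + 1 = 2 then (1 : L) else 0) (IsCMField.complexConj_ne_one L) w hw) γ₂ : ↥(unitaryGroupOfForm (galAdicCompletionMap (L := L) (IsCMField.complexConj L) hw) (placeForm (Matrix.of fun i j : Fin 2 => if i.val + j.val + 1 = 2 then (1 : L) else 0) w.1))) : GL (Fin 2) (w.1.adicCompletion L)) B = B ∧ B.map ((Matrix.toLin' (((((localNonsplitEquiv (IsCMField.complexConj L) (Matrix.of fun i j : Fin 2 => if i.val + j.val + 1 = 2 then (1 : L) else 0) (IsCMField.complexConj_ne_one L) w hw) γ₂ : ↥(unitaryGroupOfForm (galAdicCompletionMap (L := L) (IsCMField.complexConj L) hw)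 (placeForm (Matrix.of fun i j : Fin 2 => if i.val + j.val + 1 = 2 then (1 : L) else 0) w.1))) : GL (Fin 2) (w.1.adicCompletion L)) : Matrix (Fin 2) (Fin 2) (w.1.adicCompletion L)) - 1)).restrictScalars (Valued.integer (w.1.adicCompletion L))) ≤ scaleLattice ((ϖ : (w.1.adicCompletion L)) ^ D) B} =
      {B : Submodule (Valued.integer (w.1.adicCompletion L)) (Fin 2 → (w.1.adicCompletion L)) | IsSelfDualLattice (galAdicCompletionMap (L := L) (IsCMField.complexConj L) hw) (ϖ : (w.1.adicCompletion L)) (placeForm (Matrix.of fun i j : Fin 2 => if i.val + j.val + 1 = 2 then (1 : L) else 0) w.1) B ∧ mapGL (((localNonsplitEquiv (IsCMField.complexConj L) (Matrix.of fun i j : Fin 2 => if i.val + j.val + 1 = 2 then (1 : L) else 0) (IsCMField.complexConj_ne_one L) w hw) γ₂ : ↥(unitaryGroupOfForm (galAdicCompletionMap (L := L) (IsCMField.complexConj L) hw) (placeForm (Matrix.of fun i j : Fin 2 => if i.val + j.val + 1 = 2 then (1 : L) else 0) w.1))) : GL (Fin 2) (w.1.adicCompletion L)) B = B ∧ B.map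 ((Matrix.toLin' (((((localNonsplitEquiv (IsCMField.complexConj L) (Matrix.of fun i j : Fin 2 => if i.val + j.val + 1 = 2 then (1 : L) else 0) (IsCMField.complexConj_ne_one L) w hw) γ₂ : ↥(unitaryGroupOfForm (galAdicCompletionMap (L := L) (IsCMField.complexConj L) hw) (placeForm (Matrix.of fun i j : Fin 2 => if i.val + j.val + 1 = 2 then (1 : L) else 0) w.1))) : GL (Fin 2) (w.1.adicCompletion L)) : Matrix (Fin 2) (Fin 2) (w.1.adicCompletion L)) - ((((((localNonsplitEquiv (IsCMField.complexConj L) (Matrix.of fun i j : Fin 2 => if i.val + j.val + 1 = 2 then (1 : L) else 0) (IsCMField.complexConj_ne_one L) w hw) γ₂ : ↥(unitaryGroupOfForm (galAdicCompletionMap (L := L) (IsCMField.complexConj L) hw) (placeForm (Matrix.of fun i j : Fin 2 => if i.val + j.val + 1 = 2 then (1 : L) else 0) w.1))) : GL (Fin 2) (w.1.adicCompletion L)) : Matrix (Fin 2) (Fin 2) (w.1.adicCompletion L))).trace / 2) • (1 : Matrix (Fin 2) (Fin 2) (w.1.adicCompletion L)))).restrictScalars (Valued.integer (w.1.adicCompletion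 L))) ≤ scaleLattice ((ϖ : (w.1.adicCompletion L)) ^ D) B} :=
    Set.ext fun B => and_congr_right fun _ => and_congr_right fun _ =>
      (map_sub_smul_one_le_scaleLattice_iff_map_sub_one_le (((((localNonsplitEquiv (IsCMField.complexConj L) (Matrix.of fun i j : Fin 2 => if i.val + j.val + 1 = 2 then (1 : L) else 0) (IsCMField.complexConj_ne_one L) w hw) γ₂ : ↥(unitaryGroupOfForm (galAdicCompletionMap (L := L) (IsCMField.complexConj L) hw) (placeForm (Matrix.of fun i j : Fin 2 => if i.val + j.val + 1 = 2 then (1 : L) else 0) w.1))) : GL (Fin 2) (w.1.adicCompletion L)) : Matrix (Fin 2) (Fin 2) (w.1.adicCompletion L))) (pow_ne_zero D hϖ0) hcD B).symm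
  rw [hset1]
  obtain ⟨j, hj | hj⟩ := Nat.even_or_odd' D
  · subst hj
    rw [Nat.mul_div_cancel_left j two_pos] at hDn ⊢
    exact ncard_selfDual_fixed_centredBall_eq_of_odd_depth_ramified L v w hw he h2 ϖ hϖ hσϖ γ₂ hirr hN hDn
  · subst hj
    rw [show (2 * j + 1) / 2 = j by omega] at hDn ⊢
    -- «odd scales are free»: the centred ball of radius `ϖ^(2j+1)` is the centred ball of radius `ϖ^(2j)`
    have hset2 : {B : Submodule (Valued.integer (w.1.adicCompletion L)) (Fin 2 → (w.1.adicCompletion L)) | IsSelfDualLattice (galAdicCompletionMap (L := L) (IsCMField.complexConj L) hw) (ϖ : (w.1.adicCompletion L)) (placeForm (Matrix.of fun i j : Fin 2 => if i.val + j.val + 1 = 2 then (1 : L) else 0) w.1) B ∧ mapGL (((localNonsplitEquiv (IsCMField.complexConj L) (Matrix.of fun i j : Fin 2 => if i.val + j.val + 1 = 2 then (1 : L) else 0) (IsCMField.complexConj_ne_one L) w hw) γ₂ : ↥(unitaryGroupOfForm (galAdicCompletionMap (L := L) (IsCMField.complexConj L) hw) (placeForm (Matrix.of fun i j : Fin 2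 => if i.val + j.val + 1 = 2 then (1 : L) else 0) w.1))) : GL (Fin 2) (w.1.adicCompletion L)) B = B ∧ B.map ((Matrix.toLin' (((((localNonsplitEquiv (IsCMField.complexConj L) (Matrix.of fun i j : Fin 2 => if i.val + j.val + 1 = 2 then (1 : L) else 0) (IsCMField.complexConj_ne_one L) w hw) γ₂ : ↥(unitaryGroupOfForm (galAdicCompletionMap (L := L) (IsCMField.complexConj L) hw) (placeForm (Matrix.of fun i j : Fin 2 => if i.val + j.val + 1 = 2 then (1 : L) else 0) w.1))) : GL (Fin 2) (w.1.adicCompletion L)) : Matrix (Fin 2) (Fin 2) (w.1.adicCompletion L)) - ((((((localNonsplitEquiv (IsCMField.complexConj L) (Matrix.of fun i j : Fin 2 => if i.val + j.val + 1 = 2 then (1 : L) else 0) (IsCMField.complexConj_ne_one L) w hw) γ₂ : ↥(unitaryGroupOfForm (galAdicCompletionMap (L := L) (IsCMField.complexConj L) hw) (placeForm (Matrix.of fun i j : Fin 2 => if i.val + j.val + 1 = 2 then (1 : L) else 0) w.1))) : GL (Fin 2) (w.1.adicCompletion L)) : Matrix (Fin 2) (Fin 2) (w.1.adicCompletion L))).trace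 / 2) • (1 : Matrix (Fin 2) (Fin 2) (w.1.adicCompletion L)))).restrictScalars (Valued.integer (w.1.adicCompletion L))) ≤ scaleLattice ((ϖ : (w.1.adicCompletion L)) ^ (2 * j + 1)) B} =
        {B : Submodule (Valued.integer (w.1.adicCompletion L)) (Fin 2 → (w.1.adicCompletion L)) | IsSelfDualLattice (galAdicCompletionMap (L := L) (IsCMField.complexConj L) hw) (ϖ : (w.1.adicCompletion L)) (placeForm (Matrix.of fun i j : Fin 2 => if i.val + j.val + 1 = 2 then (1 : L) else 0) w.1) B ∧ mapGL (((localNonsplitEquiv (IsCMField.complexConj L) (Matrix.of fun i j : Fin 2 => if i.val + j.val + 1 = 2 then (1 : L) else 0) (IsCMField.complexConj_ne_one L) w hw) γ₂ : ↥(unitaryGroupOfForm (galAdicCompletionMap (L := L) (IsCMField.complexConj L) hw) (placeForm (Matrix.of fun i j : Fin 2 => if i.val + j.val + 1 = 2 then (1 : L) else 0) w.1))) : GL (Fin 2) (w.1.adicCompletion L)) B = B ∧ B.map ((Matrix.toLin' (((((localNonsplitEquiv (IsCMField.complexConj L) (Matrix.of fun i j : Fin 2 => if i.val + j.val + 1 =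 2 then (1 : L) else 0) (IsCMField.complexConj_ne_one L) w hw) γ₂ : ↥(unitaryGroupOfForm (galAdicCompletionMap (L := L) (IsCMField.complexConj L) hw) (placeForm (Matrix.of fun i j : Fin 2 => if i.val + j.val + 1 = 2 then (1 : L) else 0) w.1))) : GL (Fin 2) (w.1.adicCompletion L)) : Matrix (Fin 2) (Fin 2) (w.1.adicCompletion L)) - ((((((localNonsplitEquiv (IsCMField.complexConj L) (Matrix.of fun i j : Fin 2 => if i.val + j.val + 1 = 2 then (1 : L) else 0) (IsCMField.complexConj_ne_one L) w hw) γ₂ : ↥(unitaryGroupOfForm (galAdicCompletionMap (L := L) (IsCMField.complexConj L) hw) (placeForm (Matrix.of fun i j : Fin 2 => if i.val + j.val + 1 = 2 then (1 : L) else 0) w.1))) : GL (Fin 2) (w.1.adicCompletion L)) : Matrix (Fin 2) (Fin 2) (w.1.adicCompletion L))).trace / 2) • (1 : Matrix (Fin 2) (Fin 2) (w.1.adicCompletion L)))).restrictScalars (Valued.integer (w.1.adicCompletion L))) ≤ scaleLattice ((ϖ : (w.1.adicCompletion L)) ^ (2 * j)) B} := by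
      ext B
      simp only [Set.mem_setOf_eq]
      refine ⟨fun h => ⟨h.1, h.2.1, h.2.2.trans (scaleLattice_pow_succ_le hϖ1 B (2 * j))⟩, fun h => ⟨h.1, h.2.1, ?_⟩⟩
      rcases Nat.eq_zero_or_pos j with rfl | hj1
      · -- `j = 0`: every fixed self-dual `B` has PLAIN `LEV(ϖ)` (★ (W1)), hence centred `LEV(ϖ)` (`|c − 1| ≤ |ϖ|`)
        have hD1' : Valued.v (((((((localNonsplitEquiv (IsCMField.complexConj L) (Matrix.of fun i j : Fin 2 => if i.val + j.val + 1 = 2 then (1 : L) else 0) (IsCMField.complexConj_ne_one L) w hw) γ₂ : ↥(unitaryGroupOfForm (galAdicCompletionMap (L := L) (IsCMField.complexConj L) hw) (placeForm (Matrix.of fun i j : Fin 2 => if i.val + j.val + 1 = 2 then (1 : L) else 0) w.1))) : GL (Fin 2) (w.1.adicCompletion L)) : Matrix (Fin 2) (Fin 2) (w.1.adicCompletion L))).trace / 2) ^ 2 - (((((localNonsplitEquiv (IsCMField.complexConj L) (Matrix.of fun i j : Fin 2 => if i.val + j.val + 1 = 2 then (1 : L) else 0) (IsCMField.complexConj_ne_one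 L) w hw) γ₂ : ↥(unitaryGroupOfForm (galAdicCompletionMap (L := L) (IsCMField.complexConj L) hw) (placeForm (Matrix.of fun i j : Fin 2 => if i.val + j.val + 1 = 2 then (1 : L) else 0) w.1))) : GL (Fin 2) (w.1.adicCompletion L)) : Matrix (Fin 2) (Fin 2) (w.1.adicCompletion L))).det) < 1 := by
          rw [e4, map_div₀, h4v, div_one, hN, ← WithZero.exp_zero]
          exact WithZero.exp_lt_exp.2 (by omega)
        have hplain := map_sub_one_le_scaleLattice_of_fixed_selfDual_two hσ hϖ hres h2w hH₂ hγ htr hclt hD1' h.1 h.2.1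
        rw [Nat.mul_zero, zero_add, pow_one]
        exact (map_sub_smul_one_le_scaleLattice_iff_map_sub_one_le (((((localNonsplitEquiv (IsCMField.complexConj L) (Matrix.of fun i j : Fin 2 => if i.val + j.val + 1 = 2 then (1 : L) else 0) (IsCMField.complexConj_ne_one L) w hw) γ₂ : ↥(unitaryGroupOfForm (galAdicCompletionMap (L := L) (IsCMField.complexConj L) hw) (placeForm (Matrix.of fun i j : Fin 2 => if i.val + j.val + 1 = 2 then (1 : L) else 0) w.1))) : GL (Fin 2) (w.1.adicCompletion L)) : Matrix (Fin 2) (Fin 2) (w.1.adicCompletion L))) hϖ0 hcDϖ B).2 hplain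
      · have hDisc : Valued.v (((((((localNonsplitEquiv (IsCMField.complexConj L) (Matrix.of fun i j : Fin 2 => if i.val + j.val + 1 = 2 then (1 : L) else 0) (IsCMField.complexConj_ne_one L) w hw) γ₂ : ↥(unitaryGroupOfForm (galAdicCompletionMap (L := L) (IsCMField.complexConj L) hw) (placeForm (Matrix.of fun i j : Fin 2 => if i.val + j.val + 1 = 2 then (1 : L) else 0) w.1))) : GL (Fin 2) (w.1.adicCompletion L)) : Matrix (Fin 2) (Fin 2) (w.1.adicCompletion L))).trace / 2) ^ 2 - (((((localNonsplitEquiv (IsCMField.complexConj L) (Matrix.of fun i j : Fin 2 => if i.val + j.val + 1 = 2 then (1 : L) else 0) (IsCMField.complexConj_ne_one L) w hw) γ₂ : ↥(unitaryGroupOfForm (galAdicCompletionMap (L := L) (IsCMField.complexConj L) hw) (placeForm (Matrix.of fun i j : Fin 2 => if i.val + j.val + 1 = 2 then (1 : L) else 0) w.1))) : GL (Fin 2) (w.1.adicCompletion L)) : Matrix (Fin 2) (Fin 2) (w.1.adicCompletion L))).det) < Valued.v (ϖ : (w.1.adicCompletion L)) ^ (2 * (2 * j)) := by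
          rw [e4, map_div₀, h4v, div_one, hN, hϖ, ← WithZero.exp_nsmul, WithZero.exp_lt_exp]
          simp only [nsmul_eq_mul]
          omega
        exact map_sub_smul_one_le_scaleLattice_succ_of_even_two hσ hvσ hσϖ hϖ hres h2w hH₂ hγ htr hclt h.1 h.2.1 (even_two_mul j) (by omega) hDisc h.2.2
    rw [hset2]
    exact ncard_selfDual_fixed_centredBall_eq_of_odd_depth_ramified L v w hw he h2 ϖ hϖ hσϖ γ₂ hirr hN hDn

end Literature.NumberTheory.Automorphic.UnitaryGroup

end
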